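/-
Copyright (c) 2026 the pub-hodgecm-mathlib formalisation cell (harness21).  Prover seat hodgecm-mathlib-LH4-p06 (g4), Track A «(D-RAM) FOUR-FRAME», unit U2H, the census leaf
(ρ2b′-X) `stub_U2H_fixedPointCensus_typeTwo_unit0` — dealer LH4-plan (g12) WORD #16 hand T5c «TORIC LEVEL CENSUS, M∕E-RAMIFIED» (payer of record LH4-p14 (g3); plan owner
LH4-p12 (g4) T5-FRAME v1 (P); twin of LH4-p08 (g4)'s T5a organ `QuadraticOrderHermitianLevel` §3 in the RAMIFIED frame).  2026-09-04.
-/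
import Literature.NumberTheory.LocalFields.QuadraticOrderHermitianDual   -- ★ p857067 (T4c: `Λ^# = y⁻¹Λ`, `y = h·x₀Θ(x₀)·c(α − ρα)`; integrality ∕ primitivity criteria) → ★ p857040 → ★ p857021
import HarnessLib

/-!
# The INTEGRAL ∧ GRAM-PRIMITIVE criterion for the dual generator `y` of an order lattice when `M ∕ E` is RAMIFIED:
# `y ∈ 𝒪_j ∧ y∕ϖ_E ∉ 𝒪_j ⟺ (|y| ≤ 1 ∧ |y − ρy| ≤ r) ∧ (exp(−1) ≤ |y| ∨ r·exp(−1) ≤ |y − ρy|)` — `ϖ_E` a `ρ`-fixed element of value `exp(−2)`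
(Jacobowitz 1962 §4 (scales of hermitian lattices); Serre, *Local Fields* Ch. V §3)

Topic `NumberTheory/LocalFields`; namespace `Literature.NumberTheory.LocalFields.QuadraticOrder` (= ★ T4 parts I–III p857021 ∕ p857040 ∕ p857067).  THEOREMS ONLY (no definition,
no instance, no notation, no named fact, no `sorry`); kernel lane `--supports stmt-HodgeConjecture-24833` (count-neutral).  Cell `pub/hodgecm-mathlib` (D-0151), crux H413, Track A
«(D-RAM) FOUR-FRAME», unit U2H: in the toric ∕ order reduction of the WILD type-(2) fixed-point census (ρ2b′-X) (LH4-p12 PAYER-PLAN-rho2bX v2 D3–D4, T5-FRAME v1 (P)(A); LH4-p14 (g3)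
RHO2BX-ORGANS v1 T5c; F0P3a-p01 (g32) E1 v0; this seat's T5c memo `T5c-RAMM-LEVEL-CENSUS.v1` (F2) «scale pinning») a `λ`-stable plane lattice is `Λ = x₀·𝒪_j` with dual generator
`y = h·x₀Θ(x₀)·ϖ_E^j(α − ρα)` (★ T4c), it is INTEGRAL iff `y ∈ 𝒪_j` and GRAM-PRIMITIVE iff `y∕ϖ_E ∉ 𝒪_j` (★ T4c `forall_mem_forall_mem_v_herm_le_one_iff` ∕ `forall_mem_exists_dual_eq_mul_iff`
at `e = ϖ_E`).  LH4-p08 (g4)'s T5a organ resolves «`∈ 𝒪_j` ∧ `∕ϖ ∉ 𝒪_j`» into a dichotomy when `ϖ_E` is a uniformiser of the ONE field (`M ∕ E` unramified, `|ϖ_E| = exp(−1)`).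
THIS FILE is the `M ∕ E`-RAMIFIED twin: the valuation is normalised on `M`, so the `ρ`-fixed uniformiser of `E` has **`|ϖ_E| = exp(−2)`** and dividing by it moves BOTH order
conditions by TWO steps; the criterion becomes «integral, and within ONE step of failing»:
* §1 `v_div_sub_map_div_eq_of_v_eq_exp_neg_two`: `|y∕ϖ_E| = |y|·exp 2`, `|y∕ϖ_E − ρ(y∕ϖ_E)| = |y − ρy|·exp 2` (`ρϖ_E = ϖ_E`).
* §1 `lt_mul_exp_two_iff`: discreteness two steps at a time — `r < x·exp 2 ⟺ r·exp(−1) ≤ x` (`x ≠ 0`).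
* §2 **`order_and_not_order_div_iff_of_v_eq_exp_neg_two`**: for any bound `r ≠ 0`,
  `(|y| ≤ 1 ∧ |y − ρy| ≤ r) ∧ ¬(|y∕ϖ_E| ≤ 1 ∧ |y∕ϖ_E − ρ(y∕ϖ_E)| ≤ r) ⟺ (|y| ≤ 1 ∧ |y − ρy| ≤ r) ∧ (exp(−1) ≤ |y| ∨ r·exp(−1) ≤ |y − ρy|)`.
* §2 `hermGen_order_and_not_order_div_iff_of_v_eq_exp_neg_two`: the same for `y = h·x₀Θ(x₀)·c(α − ρα)` with the order bound `r = |c(α − ρα)|` of ★ T4 (`c ≠ 0`, `ρα ≠ α`) —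
  the sentence the T5c level census (`T5cToricLevelCensusRamM` skeleton, `levelSet`) starts from; with LH4-p12 (g4)'s factorisation `y = k·ϖ_E^j·δ`, `k ∈ K♮` it is T5-FRAME (P).
* §3 WITH PARITY (`ρ`-fixed elements have even valuation — every ★ `IsRamifiedQuadraticDatum`): `v_sub_map_ne_of_even` (`|y − ρy| = |b(y)|·|α − ρα| ∈ exp(2ℤ)·|α − ρα| ∪ {0}` is never
  ONE step below the bound) and **`order_and_not_order_div_iff_of_even`**: for `|y| = |ϖE|^a` the criterion is the EXACT dichotomy `(a = 0 ∧ |y − ρy| ≤ r) ∨ (1 ≤ a ∧ |y − ρy| = r)`,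
  `r = |ϖE^j(α − ρα)|` — F0P3-p01 (g32) (L-RM1) «`a = j − min(depth Y, j)`» ∕ LH4-p08 (g4) (M2) shape, now in the ramified frame.
HONEST LABEL: HC_CM is proved only modulo the 7 printed citations (2 remaining named inputs: hLiu418 = stmt-HodgeConjecture-24832, h413 = stmt-HodgeConjecture-24833) until rung 0
closes; unconditional local algebra, count-neutral (one step of organ T5c of the (ρ2b′-X) payer plan; the census itself is an OPEN prover target).

## References
* [Jacobowitz1962] R. Jacobowitz, *Hermitian forms over local fields*, Amer. J. Math. 84 (1962): §4 (hermitian lattices, duals `L^#`, scales and norms; modular lattices).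
* [Serre1979] J.-P. Serre, *Local Fields*, GTM 67 (1979): Ch. V §3 (ramified quadratic extensions: valuations, the filtration `U^{(n)}`), Ch. III §6 Prop. 11 (Euler).
-/

set_option autoImplicit false

open WithZero

namespace Literature.NumberTheory.LocalFields.QuadraticOrder

variable {K : Type*} [Field K] [Valued K ℤᵐ⁰] {ρ Θ : K →+* K} {α : K}

/-! ## §1 Two-step bookkeeping: dividing by a `ρ`-fixed element of value `exp(−2)` -/

/-- **DISCRETENESS, TWO STEPS AT A TIME: `r < x·exp 2 ⟺ r·exp(−1) ≤ x`** (`x ≠ 0`; `exp 2 = exp 1·exp 1` and ★ `lt_mul_exp_iff_le`). [cite: Serre1979, Ch. V §3] -/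
theorem lt_mul_exp_two_iff {x r : ℤᵐ⁰} (hx : x ≠ 0) : r < x * exp (2 : ℤ) ↔ r * exp (-1 : ℤ) ≤ x := by
  have h1 : x * exp (1 : ℤ) ≠ 0 := mul_ne_zero hx exp_ne_zero
  rw [show (2 : ℤ) = 1 + 1 from rfl, exp_add, ← mul_assoc, lt_mul_exp_iff_le h1, exp_neg,
    mul_inv_le_iff₀ (exp_pos : (0 : ℤᵐ⁰) < exp 1)]

/-- Dividing by a `ρ`-FIXED element of value `exp(−2)` (the uniformiser of `E` seen in `M`, `M ∕ E` ramified): `y∕ϖ − ρ(y∕ϖ) = (y − ρy)∕ϖ`, so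
**`|y∕ϖ − ρ(y∕ϖ)| = |y − ρy|·exp 2` and `|y∕ϖ| = |y|·exp 2`**. [cite: Serre1979, Ch. V §3] -/
theorem v_div_sub_map_div_eq_of_v_eq_exp_neg_two {ϖ : K} (hϖ : Valued.v ϖ = exp (-2 : ℤ)) (hρϖ : ρ ϖ = ϖ) (y : K) :
    Valued.v (y / ϖ - ρ (y / ϖ)) = Valued.v (y - ρ y) * exp (2 : ℤ) ∧ Valued.v (y / ϖ) = Valued.v y * exp (2 : ℤ) := by
  have hinv : (Valued.v ϖ)⁻¹ = exp (2 : ℤ) := by rw [hϖ, ← exp_neg, neg_neg]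
  refine ⟨?_, ?_⟩
  · rw [map_div₀, hρϖ, ← sub_div, map_div₀, div_eq_mul_inv, hinv]
  · rw [map_div₀, div_eq_mul_inv, hinv]

/-! ## §2 The integral ∧ Gram-primitive criterion in the `M ∕ E`-RAMIFIED frame -/

/-- **THE INTEGRAL ∧ GRAM-PRIMITIVE CRITERION, `M ∕ E` RAMIFIED** (T5c; LH4-p12 (g4) T5-FRAME v1 (P)).  For `ϖ` `ρ`-fixed with `|ϖ| = exp(−2)` and any bound `r ≠ 0` (the order
bound `|c(α − ρα)|`): `y` satisfies the order predicate `|y| ≤ 1 ∧ |y − ρy| ≤ r` and `y∕ϖ` does NOT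
**`⟺ (|y| ≤ 1 ∧ |y − ρy| ≤ r) ∧ (exp(−1) ≤ |y| ∨ r·exp(−1) ≤ |y − ρy|)`** — integral, and at least one of the two order conditions within ONE valuation step of its bound
(contrast the unramified frame, where the step is `exp 1` and the criterion is an exact dichotomy `|y| = 1 ∨ |y − ρy| = r`). [cite: Jacobowitz1962, §4] [cite: Serre1979, Ch. V §3] -/
theorem order_and_not_order_div_iff_of_v_eq_exp_neg_two {ϖ : K} (hϖ : Valued.v ϖ = exp (-2 : ℤ)) (hρϖ : ρ ϖ = ϖ) {r : ℤᵐ⁰} (hr : r ≠ 0) (y : K) :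
    ((Valued.v y ≤ 1 ∧ Valued.v (y - ρ y) ≤ r) ∧ ¬ (Valued.v (y / ϖ) ≤ 1 ∧ Valued.v (y / ϖ - ρ (y / ϖ)) ≤ r)) ↔
      (Valued.v y ≤ 1 ∧ Valued.v (y - ρ y) ≤ r) ∧ (exp (-1 : ℤ) ≤ Valued.v y ∨ r * exp (-1 : ℤ) ≤ Valued.v (y - ρ y)) := by
  obtain ⟨h1, h2⟩ := v_div_sub_map_div_eq_of_v_eq_exp_neg_two (ρ := ρ) hϖ hρϖ y
  rw [h1, h2, and_congr_right_iff]
  rintro ⟨hy1, hyr⟩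
  rw [not_and_or, not_le, not_le]
  by_cases hy0 : Valued.v y = 0
  · -- `y = 0`: both sides are false (`0·exp 2 = 0` is integral and `ρ`-deep; `exp(−1) ≰ 0`, `r·exp(−1) ≰ 0`)
    have hy : y = 0 := (Valuation.zero_iff _).1 hy0
    subst hy
    simp only [map_zero, sub_zero, zero_mul]
    constructor
    · rintro (h | h)
      · exact absurd h (not_lt.2 zero_le)
      · exact absurd h (not_lt.2 zero_le)
    · rintro (h | h)
      · exact absurd h (not_le.2 exp_pos)
      · exact absurd h (not_le.2 (mul_pos (pos_iff_ne_zero.2 hr) exp_pos))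
  · rw [lt_mul_exp_two_iff hy0, one_mul]
    by_cases hd0 : Valued.v (y - ρ y) = 0
    · rw [hd0, zero_mul]
      constructor
      · rintro (h | h)
        · exact Or.inl h
        · exact absurd h (not_lt.2 zero_le)
      · rintro (h | h)
        · exact Or.inl h
        · exact absurd h (not_le.2 (mul_pos (pos_iff_ne_zero.2 hr) exp_pos))
    · rw [lt_mul_exp_two_iff hd0]

/-- **THE CRITERION FOR THE DUAL GENERATOR `y = h·x₀Θ(x₀)·c(α − ρα)` of `x₀·𝒪_j`, `M ∕ E` RAMIFIED** (`|ϖ| = exp(−2)`, `ρϖ = ϖ`, conductor `c ≠ 0`, `ρα ≠ α`): `y` lies in the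
order of conductor `c` and `y∕ϖ` does not — i.e. `x₀·𝒪_j` is INTEGRAL and GRAM-PRIMITIVE for `Tr(h·Θ(a)·b)` by ★ T4c — iff
`(|y| ≤ 1 ∧ |y − ρy| ≤ |c(α − ρα)|) ∧ (exp(−1) ≤ |y| ∨ |c(α − ρα)|·exp(−1) ≤ |y − ρy|)`.  This is the sentence the T5c level census reads its levels from
(`2a = v_M(y)`; T5-FRAME (P)(A) after `y = k·ϖ_E^j·(α − ρα)`, `k ∈ K♮`). [cite: Jacobowitz1962, §4] [cite: Serre1979, Ch. V §3] -/
theorem hermGen_order_and_not_order_div_iff_of_v_eq_exp_neg_two {ϖ : K} (hϖ : Valued.v ϖ = exp (-2 : ℤ)) (hρϖ : ρ ϖ = ϖ)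
    (hα : ρ α ≠ α) {c : K} (hc0 : c ≠ 0) (h x₀ : K) :
    ((Valued.v (h * (x₀ * Θ x₀) * (c * (α - ρ α))) ≤ 1 ∧
        Valued.v (h * (x₀ * Θ x₀) * (c * (α - ρ α)) - ρ (h * (x₀ * Θ x₀) * (c * (α - ρ α)))) ≤ Valued.v (c * (α - ρ α))) ∧
      ¬ (Valued.v (h * (x₀ * Θ x₀) * (c * (α - ρ α)) / ϖ) ≤ 1 ∧
        Valued.v (h * (x₀ * Θ x₀) * (c * (α - ρ α)) / ϖ - ρ (h * (x₀ * Θ x₀) * (c * (α - ρ α)) / ϖ)) ≤ Valued.v (c * (α - ρ α)))) ↔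
      (Valued.v (h * (x₀ * Θ x₀) * (c * (α - ρ α))) ≤ 1 ∧
          Valued.v (h * (x₀ * Θ x₀) * (c * (α - ρ α)) - ρ (h * (x₀ * Θ x₀) * (c * (α - ρ α)))) ≤ Valued.v (c * (α - ρ α))) ∧
        (exp (-1 : ℤ) ≤ Valued.v (h * (x₀ * Θ x₀) * (c * (α - ρ α))) ∨
          Valued.v (c * (α - ρ α)) * exp (-1 : ℤ) ≤ Valued.v (h * (x₀ * Θ x₀) * (c * (α - ρ α)) - ρ (h * (x₀ * Θ x₀) * (c * (α - ρ α))))) :=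
  order_and_not_order_div_iff_of_v_eq_exp_neg_two hϖ hρϖ
    ((Valuation.ne_zero_iff _).2 (mul_ne_zero hc0 (sub_ne_zero.2 (Ne.symm hα)))) _

/-! ## §3 With PARITY (ρ-fixed elements have even valuation — every `IsRamifiedQuadraticDatum`): the criterion is an EXACT dichotomy after all -/

/-- The `ρ`-twist `y − ρy` of ANY element is `b(y)·(α − ρα)` with `b(y) = (y − ρy)∕(α − ρα)` `ρ`-FIXED (★ part I); so under PARITY (nonzero `ρ`-fixed elements have
valuation in `exp(2ℤ)`) the value `|y − ρy|` lies in `exp(2ℤ)·|α − ρα| ∪ {0}` — it can never sit ONE step below the order bound `|ϖE^j(α − ρα)|` (`|ϖE| = exp(−2)`).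
[cite: Serre1979, Ch. V §3] -/
theorem v_sub_map_ne_of_even (hρρ : ∀ x, ρ (ρ x) = x) (hα : ρ α ≠ α) (hfix : ∀ c : K, ρ c = c → c ≠ 0 → ∃ n : ℤ, Valued.v c = exp (2 * n))
    {ϖE : K} (hϖ : Valued.v ϖE = exp (-2 : ℤ)) (j : ℕ) (y : K) :
    Valued.v (y - ρ y) ≠ Valued.v (ϖE ^ j * (α - ρ α)) * exp (-1 : ℤ) := by
  have hd : α - ρ α ≠ 0 := sub_ne_zero.2 (Ne.symm hα)
  have hvd : Valued.v (α - ρ α) ≠ 0 := (Valuation.ne_zero_iff _).2 hd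
  have e1 : Valued.v (y - ρ y) = Valued.v ((y - ρ y) / (α - ρ α)) * Valued.v (α - ρ α) := by
    rw [← map_mul, div_mul_cancel₀ _ hd]
  have e2 : Valued.v (ϖE ^ j * (α - ρ α)) * exp (-1 : ℤ) = exp (-(2 * (j : ℤ)) - 1) * Valued.v (α - ρ α) := by
    rw [map_mul, map_pow, hϖ, ← exp_nsmul, mul_right_comm, ← exp_add]
    congr 2
    simp only [nsmul_eq_mul]
    ring
  intro h
  rw [e1, e2] at h
  have h' := mul_right_cancel₀ hvd h
  by_cases hb0 : (y - ρ y) / (α - ρ α) = 0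
  · rw [hb0, map_zero] at h'
    exact (exp_ne_zero h'.symm).elim
  · obtain ⟨n, hn⟩ := hfix _ (map_bCoord hρρ α y) hb0
    rw [hn, exp_inj] at h'
    omega

/-- **THE INTEGRAL ∧ GRAM-PRIMITIVE DICHOTOMY, `M ∕ E` RAMIFIED, WITH PARITY** (g32 (L-RM1) «`a = j − min(depth Y, j)`»): for `|ϖE| = exp(−2)`, `ρϖE = ϖE`, `ρ`-fixed elements of even
valuation, and `|y| = |ϖE|^a`: `y ∈ 𝒪_{ϖE^j} ∧ y∕ϖE ∉ 𝒪_{ϖE^j}` **iff `(a = 0 ∧ |y − ρy| ≤ |ϖE^j(α − ρα)|) ∨ (1 ≤ a ∧ |y − ρy| = |ϖE^j(α − ρα)|)`** — level `0`: ρ-depth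
at least the conductor; level `a ≥ 1`: ρ-depth EXACTLY `j − a` (`|y − ρy| = |ϖE|^a·|b(Y)|·|α − ρα|`, `Y = y∕ϖE^a`).  Same shape as the unramified dichotomy (LH4-p08 (g4) (M2)); the
one-step-below option of §2 is excluded by parity. [cite: Jacobowitz1962, §4] [cite: Serre1979, Ch. V §3] -/
theorem order_and_not_order_div_iff_of_even (hρρ : ∀ x, ρ (ρ x) = x) (hα : ρ α ≠ α)
    (hfix : ∀ c : K, ρ c = c → c ≠ 0 → ∃ n : ℤ, Valued.v c = exp (2 * n))
    {ϖE : K} (hϖ : Valued.v ϖE = exp (-2 : ℤ)) (hρϖ : ρ ϖE = ϖE) {y : K} {a : ℕ} (hy : Valued.v y = Valued.v ϖE ^ a) (j : ℕ) :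
    ((Valued.v y ≤ 1 ∧ Valued.v (y - ρ y) ≤ Valued.v (ϖE ^ j * (α - ρ α))) ∧
        ¬ (Valued.v (y / ϖE) ≤ 1 ∧ Valued.v (y / ϖE - ρ (y / ϖE)) ≤ Valued.v (ϖE ^ j * (α - ρ α)))) ↔
      (a = 0 ∧ Valued.v (y - ρ y) ≤ Valued.v (ϖE ^ j * (α - ρ α))) ∨ (1 ≤ a ∧ Valued.v (y - ρ y) = Valued.v (ϖE ^ j * (α - ρ α))) := by
  have hd : α - ρ α ≠ 0 := sub_ne_zero.2 (Ne.symm hα)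
  have hϖ0 : ϖE ≠ 0 := fun h0 => by rw [h0, map_zero] at hϖ; exact (exp_ne_zero hϖ.symm).elim
  have hr : Valued.v (ϖE ^ j * (α - ρ α)) ≠ 0 := (Valuation.ne_zero_iff _).2 (mul_ne_zero (pow_ne_zero _ hϖ0) hd)
  have hrpos : 0 < Valued.v (ϖE ^ j * (α - ρ α)) * exp (-1 : ℤ) := mul_pos (zero_lt_iff.2 hr) exp_pos
  have hya' : Valued.v y = exp (-(2 * (a : ℤ))) := by
    rw [hy, hϖ, ← exp_nsmul]; congr 1; simp only [nsmul_eq_mul]; ring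
  have hy1 : Valued.v y ≤ 1 := by rw [hya', ← exp_zero, exp_le_exp]; omega
  have hya : exp (-1 : ℤ) ≤ Valued.v y ↔ a = 0 := by rw [hya', exp_le_exp]; omega
  rw [order_and_not_order_div_iff_of_v_eq_exp_neg_two hϖ hρϖ hr y, hya]
  have hne := v_sub_map_ne_of_even hρρ hα hfix hϖ j y
  constructor
  · rintro ⟨⟨-, hle⟩, h0 | hge⟩
    · exact Or.inl ⟨h0, hle⟩
    · -- `r·exp(−1) ≤ |y − ρy| ≤ r` and `|y − ρy| ≠ r·exp(−1)`: so `|y − ρy| = r`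
      have hlt : Valued.v (ϖE ^ j * (α - ρ α)) * exp (-1 : ℤ) < Valued.v (y - ρ y) := lt_of_le_of_ne hge (Ne.symm hne)
      have hv0 : Valued.v (y - ρ y) ≠ 0 := ne_of_gt (hrpos.trans hlt)
      have hge' : Valued.v (ϖE ^ j * (α - ρ α)) ≤ Valued.v (y - ρ y) := by
        rw [exp_neg] at hlt
        exact (lt_mul_exp_iff_le hv0).1 ((mul_inv_lt_iff₀ exp_pos).1 hlt)
      rcases Nat.eq_zero_or_pos a with h0 | hpos
      · exact Or.inl ⟨h0, hle⟩
      · exact Or.inr ⟨hpos, le_antisymm hle hge'⟩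
  · rintro (⟨h0, hle⟩ | ⟨hpos, heq⟩)
    · exact ⟨⟨hy1, hle⟩, Or.inl h0⟩
    · refine ⟨⟨hy1, heq.le⟩, Or.inr ?_⟩
      rw [heq]
      exact mul_le_of_le_one_right' (by rw [← exp_zero, exp_le_exp]; omega)

end Literature.NumberTheory.LocalFields.QuadraticOrder
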